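import Literature.Topology.FourManifolds.GenericMapCuspsFinite
import Literature.Topology.FourManifolds.RegularLevelSet
import HarnessLib

/-!
# The critical set through a cusp point is a smooth arc

Topic `Literature/Topology/FourManifolds` (programme of the fact
`Literature.Topology.FourManifolds.exists_isSimplifiedBrokenLefschetzFibration`, Baykur–Saeki 2017, §2.1
p. 6: the singular set of a generic map `X⁴ → Σ²` is a smooth 1-dimensional submanifold,
folds and cusps alike).  `FoldLocusArc` produced the arc of critical points through a fold
point; here the same is done at a cusp point with Whitney data
(`HasManifoldWhitneyCuspCharts g p`): in the chart the critical set of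
`(t, h(t,x) + ε₂y² + ε₃z²)` is `{hₓ(t,x) = 0, y = z = 0}` (`critical_cuspModel_iff`), and
since `hₜₓ(0) ≠ 0` the planar curve `{hₓ = 0}` is, near `0`, a graph `t = τ(x)` over the
kernel direction (inverse function theorem applied to `Θ(t, x) = (hₓ(t, x), x)`).  Hence the
critical points of `g` near `p` form the arc `γ(x) = φ⁻¹(τ(x), x, 0, 0)`, `C^∞` and injective.

* `exists_cuspCritCurve` — the planar statement;
* `HasManifoldWhitneyCuspCharts.exists_arc` — the arc of critical points through a cusp.

Everything is proved; no definitions, no named facts (D-0026).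

## References

* R. İ. Baykur, O. Saeki, *Simplifying indefinite fibrations on 4-manifolds*, arXiv:1705.11169,
  §2.1, p. 6. [BaykurSaeki2017]
* M. Golubitsky, V. Guillemin, *Stable Mappings and Their Singularities*, GTM 14 (1973), Ch. VI
  §2 (the singular set `S₁(f)` of a generic map of the plane is a smooth curve through the
  cusps). [GolubitskyGuillemin1973]
-/

noncomputable section

set_option maxSynthPendingDepth 2

open Set Function Filter Module
open scoped ContDiff Topology Manifold

namespace Literature.Topology.FourManifolds

/-- Local notation for this file: the model space `ℝⁿ = EuclideanSpace ℝ (Fin n)`. -/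
local notation "𝔼 " n:arg => EuclideanSpace ℝ (Fin n)

/-! ### The planar curve `{hₓ = 0}` near a point with `hₜₓ ≠ 0` -/

/-- Decomposition of a vector of the plane along the coordinate axes. [folklore] -/
private theorem prod_eq_smul_add_smul' (v : ℝ × ℝ) :
    v = v.1 • ((1 : ℝ), (0 : ℝ)) + v.2 • ((0 : ℝ), (1 : ℝ)) := by
  ext <;> simp

/-- **The curve `{hₓ = 0}` is a graph over the kernel direction.**  If `h` is `C^∞` near `0`
with `hₓ(0) = 0` and `hₜₓ(0) ≠ 0`, there are an open `V ∋ 0`, a `C^∞` function `τ` on `V`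
with `τ 0 = 0` and `hₓ(τ x, x) = 0`, and an open `W ∋ 0` on which `hₓ(t, x) = 0` forces
`x ∈ V` and `t = τ x`. [cite: GolubitskyGuillemin1973, Ch. VI §2] -/
theorem exists_cuspCritCurve {h : ℝ × ℝ → ℝ} {U : Set (ℝ × ℝ)} (hU : IsOpen U)
    (h0 : (0 : ℝ × ℝ) ∈ U) (hh : ContDiffOn ℝ ∞ h U) (hx : fderiv ℝ h 0 ((0 : ℝ), (1 : ℝ)) = 0)
    (htx : fderiv ℝ (fderiv ℝ h) 0 ((1 : ℝ), (0 : ℝ)) ((0 : ℝ), (1 : ℝ)) ≠ 0) :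
    ∃ (V : Set ℝ) (τ : ℝ → ℝ) (W : Set (ℝ × ℝ)), IsOpen V ∧ (0 : ℝ) ∈ V ∧ ContDiffOn ℝ ∞ τ V ∧
      τ 0 = 0 ∧ (∀ x ∈ V, (τ x, x) ∈ U ∧ fderiv ℝ h (τ x, x) ((0 : ℝ), (1 : ℝ)) = 0) ∧
      IsOpen W ∧ (0 : ℝ × ℝ) ∈ W ∧ W ⊆ U ∧
      ∀ q ∈ W, fderiv ℝ h q ((0 : ℝ), (1 : ℝ)) = 0 → q.2 ∈ V ∧ q = (τ q.2, q.2) := by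
  set e : ℝ × ℝ := ((0 : ℝ), (1 : ℝ)) with he
  set Θ : ℝ × ℝ → ℝ × ℝ := fun q => (fderiv ℝ h q e, q.2) with hΘ
  have hd1 : ContDiffOn ℝ ∞ (fderiv ℝ h) U := hh.fderiv_of_isOpen hU (by simp)
  have hΘs : ContDiffOn ℝ ∞ Θ U := (hd1.clm_apply contDiffOn_const).prodMk contDiffOn_snd
  -- the differential of `Θ` at `0` and its invertibility
  have hD1 : HasFDerivAt (fderiv ℝ h) (fderiv ℝ (fderiv ℝ h) 0) 0 :=
    ((hd1.contDiffAt (hU.mem_nhds h0)).differentiableAt (by simp)).hasFDerivAt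
  set T₁ : ℝ × ℝ →L[ℝ] ℝ :=
    (ContinuousLinearMap.apply ℝ ℝ e).comp (fderiv ℝ (fderiv ℝ h) 0) with hT₁
  have hΘ1 : HasFDerivAt (fun q => fderiv ℝ h q e) T₁ 0 :=
    (ContinuousLinearMap.apply ℝ ℝ e).hasFDerivAt.comp 0 hD1
  have hΘd : HasFDerivAt Θ (T₁.prod (ContinuousLinearMap.snd ℝ ℝ ℝ)) 0 :=
    hΘ1.prodMk (ContinuousLinearMap.snd ℝ ℝ ℝ).hasFDerivAt
  have hT₁v : ∀ v, T₁ v = fderiv ℝ (fderiv ℝ h) 0 v e := fun v => by simp [hT₁]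
  have hinj : Injective (T₁.prod (ContinuousLinearMap.snd ℝ ℝ ℝ)) := by
    intro v w hvw
    rw [← sub_eq_zero] at hvw ⊢
    rw [← map_sub] at hvw
    set u := v - w with hu
    have h1 : T₁ u = 0 := by simpa using congrArg Prod.fst hvw
    have h2 : u.2 = 0 := by simpa using congrArg Prod.snd hvw
    rw [hT₁v, prod_eq_smul_add_smul' u, map_add, map_smul, map_smul, h2, zero_smul, add_zero,
      _root_.smul_apply, smul_eq_mul] at h1
    have hu1 : u.1 = 0 := (mul_eq_zero.1 h1).resolve_right htx
    exact Prod.ext hu1 h2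
  set L : (ℝ × ℝ) ≃L[ℝ] ℝ × ℝ :=
    (LinearMap.linearEquivOfInjective
      ((T₁.prod (ContinuousLinearMap.snd ℝ ℝ ℝ) : ℝ × ℝ →L[ℝ] ℝ × ℝ) : ℝ × ℝ →ₗ[ℝ] ℝ × ℝ)
      hinj rfl).toContinuousLinearEquiv with hL
  have hLc : (L : ℝ × ℝ →L[ℝ] ℝ × ℝ) = T₁.prod (ContinuousLinearMap.snd ℝ ℝ ℝ) :=
    ContinuousLinearMap.ext fun _ => rfl
  have hΘL : HasFDerivAt Θ (L : ℝ × ℝ →L[ℝ] ℝ × ℝ) 0 := by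
    rw [hLc]
    exact hΘd
  -- inverse function theorem
  obtain ⟨G, hGΘ, h0G, hGU, hGs, hGss⟩ :=
    exists_openPartialHomeomorph_contDiffOn_symm hU h0 (by simp) hΘs L hΘL
  have hΘ0 : Θ 0 = 0 := by
    change (fderiv ℝ h 0 e, (0 : ℝ × ℝ).2) = 0
    rw [he, hx]
    rfl
  have hG0 : G 0 = 0 := by rw [hGΘ, hΘ0]
  have h0Gt : (0 : ℝ × ℝ) ∈ G.target := hG0 ▸ G.map_source h0G
  -- the graph
  set V : Set ℝ := {x | ((0 : ℝ), x) ∈ G.target} with hV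
  have hVo : IsOpen V :=
    G.open_target.preimage (Continuous.prodMk_right (0 : ℝ))
  have h0V : (0 : ℝ) ∈ V := by
    show ((0 : ℝ), (0 : ℝ)) ∈ G.target
    exact h0Gt
  set τ : ℝ → ℝ := fun x => (G.symm ((0 : ℝ), x)).1 with hτ
  have hτs : ContDiffOn ℝ ∞ τ V :=
    contDiffOn_fst.comp (hGss.comp (contDiffOn_const.prodMk contDiffOn_id) fun x hx => hx)
      (mapsTo_univ _ _)
  have hgraph : ∀ x ∈ V, G.symm ((0 : ℝ), x) = (τ x, x) ∧ (τ x, x) ∈ U ∧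
      fderiv ℝ h (τ x, x) e = 0 := by
    intro x hxV
    set q := G.symm ((0 : ℝ), x) with hq
    have hqs : q ∈ G.source := G.map_target hxV
    have hΘq : Θ q = ((0 : ℝ), x) := by rw [← hGΘ]; exact G.right_inv hxV
    have hq2 : q.2 = x := by simpa [hΘ] using congrArg Prod.snd hΘq
    have hq1 : fderiv ℝ h q e = 0 := by simpa [hΘ] using congrArg Prod.fst hΘq
    have hqeq : q = (τ x, x) := Prod.ext rfl hq2
    refine ⟨hqeq, hqeq ▸ hGU hqs, ?_⟩
    rw [← hqeq]
    exact hq1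
  refine ⟨V, τ, G.source, hVo, h0V, hτs, ?_, fun x hx => (hgraph x hx).2, G.open_source, h0G, hGU,
    fun q hq hqx => ?_⟩
  · show (G.symm ((0 : ℝ), (0 : ℝ))).1 = 0
    have h1 : G.symm (G 0) = 0 := G.left_inv h0G
    rw [hG0] at h1
    have h2 : G.symm ((0 : ℝ), (0 : ℝ)) = 0 := h1
    rw [h2]
    rfl
  · have hGq : G q = ((0 : ℝ), q.2) := by
      rw [hGΘ]
      change (fderiv ℝ h q e, q.2) = ((0 : ℝ), q.2)
      rw [hqx]
    have hqt : ((0 : ℝ), q.2) ∈ G.target := hGq ▸ G.map_source hq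
    have hsymm : G.symm ((0 : ℝ), q.2) = q := by rw [← hGq, G.left_inv hq]
    refine ⟨hqt, ?_⟩
    rw [← (hgraph q.2 hqt).1, hsymm]

/-! ### The arc of critical points through a cusp -/

variable {X : Type*} [TopologicalSpace X] [ChartedSpace (𝔼 4) X]
  {B : Type*} [TopologicalSpace B] [ChartedSpace (𝔼 2) B]

/-- The vector `(a, b, 0, 0)` of `ℝ⁴`. [folklore] -/
private def arcPt (a b : ℝ) : 𝔼 4 := WithLp.toLp 2 ![a, b, 0, 0]

/-- Coordinate `0` of `arcPt a b` is `a`. [folklore] -/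
@[simp] private theorem arcPt_apply_zero (a b : ℝ) : arcPt a b 0 = a := rfl

/-- Coordinate `1` of `arcPt a b` is `b`. [folklore] -/
@[simp] private theorem arcPt_apply_one (a b : ℝ) : arcPt a b 1 = b := rfl

/-- Coordinate `2` of `arcPt a b` is `0`. [folklore] -/
@[simp] private theorem arcPt_apply_two (a b : ℝ) : arcPt a b 2 = 0 := rfl

/-- Coordinate `3` of `arcPt a b` is `0`. [folklore] -/
@[simp] private theorem arcPt_apply_three (a b : ℝ) : arcPt a b 3 = 0 := rfl

/-- A vector of `ℝ⁴` with vanishing last two coordinates is `arcPt` of its first two. [folklore] -/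
private theorem eq_arcPt {y : 𝔼 4} (h2 : y 2 = 0) (h3 : y 3 = 0) : y = arcPt (y 0) (y 1) := by
  ext i
  fin_cases i
  · rfl
  · rfl
  · simpa using h2
  · simpa using h3

/-- `arcPt a b = a e₀ + b e₁`. [folklore] -/
private theorem arcPt_eq (a b : ℝ) :
    arcPt a b = a • EuclideanSpace.single (0 : Fin 4) (1 : ℝ) +
      b • EuclideanSpace.single (1 : Fin 4) (1 : ℝ) := by
  ext i
  fin_cases i <;> simp [arcPt]

/-- `(a, b) ↦ arcPt a b` is `C^∞` in `b` along a `C^∞` function `a = τ b`. [folklore] -/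
private theorem contDiffOn_arcPt {τ : ℝ → ℝ} {V : Set ℝ} (hτ : ContDiffOn ℝ ∞ τ V) :
    ContDiffOn ℝ ∞ (fun x => arcPt (τ x) x) V := by
  have h : (fun x => arcPt (τ x) x) = fun x => τ x • EuclideanSpace.single (0 : Fin 4) (1 : ℝ) +
      x • EuclideanSpace.single (1 : Fin 4) (1 : ℝ) := funext fun x => arcPt_eq (τ x) x
  rw [h]
  exact (hτ.smul contDiffOn_const).add (contDiffOn_id.smul contDiffOn_const)

/-- **The critical set through a cusp point is a smooth arc.**  If `g : X → B` has Whitney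
cusp charts at `p`, there are `δ > 0` and `γ : ℝ → X`, `C^∞` and injective on `(-δ, δ)`, with
`γ 0 = p`, every `γ x` a critical point of `g`, and every critical point of `g` near `p` of the
form `γ x`. [cite: BaykurSaeki2017, §2.1, p. 6] [cite: GolubitskyGuillemin1973, Ch. VI §2] -/
theorem HasManifoldWhitneyCuspCharts.exists_arc {g : X → B} {p : X}
    (hW : HasManifoldWhitneyCuspCharts g p) :
    ∃ (δ : ℝ) (γ : ℝ → X), 0 < δ ∧ γ 0 = p ∧
      ContMDiffOn 𝓘(ℝ, ℝ) (𝓡 4) ∞ γ (Ioo (-δ) δ) ∧ InjOn γ (Ioo (-δ) δ) ∧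
      (∀ x ∈ Ioo (-δ) δ, ¬ Surjective (mfderiv (𝓡 4) (𝓡 2) g (γ x))) ∧
      ∃ U ∈ 𝓝 p, ∀ q ∈ U, ¬ Surjective (mfderiv (𝓡 4) (𝓡 2) g q) → q ∈ γ '' Ioo (-δ) δ := by
  obtain ⟨φ, ψ, h, U, ε₂, ε₃, hpφ, hp0, hmaps, hφ, hφs, hψ, hψs, hU, hh, hφU, hε₂, hε₃, hid,
    -, -, hx, -, -, htx⟩ := hW
  have hε₂0 : ε₂ ≠ 0 := by rintro rfl; norm_num at hε₂
  have hε₃0 : ε₃ ≠ 0 := by rintro rfl; norm_num at hε₃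
  have h0U : (0 : ℝ × ℝ) ∈ U := by
    have := hφU p hpφ
    rw [hp0] at this
    exact (by simpa using this : ((0 : ℝ), (0 : ℝ)) ∈ U)
  -- the model and the chart identity
  set G : 𝔼 4 → 𝔼 2 := OneJet.rankOneMap (OneJet.cuspModelFn h ε₂ ε₃) with hG
  set Ω : Set (𝔼 4) := OneJet.baseProj ⁻¹' U with hΩ
  have hΩo : IsOpen Ω := hU.preimage OneJet.baseProj.continuous
  have hGs : ContDiffOn ℝ ∞ G Ω :=
    OneJet.contDiffOn_rankOneMap (OneJet.contDiffOn_cuspModelFn hh ε₂ ε₃)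
  have hφΩ : ∀ q ∈ φ.source, φ q ∈ Ω := fun q hq => hφU q hq
  have hidv : ∀ q ∈ φ.source, ψ (g q) = G (φ q) := by
    intro q hq
    obtain ⟨h0', h1'⟩ := hid q hq
    ext i
    fin_cases i
    · show ψ (g q) 0 = OneJet.rankOneMap _ (φ q) 0
      rw [OneJet.rankOneMap_apply_zero, h0']
    · show ψ (g q) 1 = OneJet.rankOneMap _ (φ q) 1
      rw [OneJet.rankOneMap_apply_one, h1']
      rfl
  have hGf : ∀ q ∈ φ.source, G =ᶠ[𝓝 (φ q)] (ψ ∘ g ∘ φ.symm) := by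
    intro q hq
    filter_upwards [φ.open_target.mem_nhds (φ.map_source hq)] with y hy
    show G y = ψ (g (φ.symm y))
    rw [hidv (φ.symm y) (φ.map_target hy), φ.right_inv hy]
  -- criticality of `g` at `q ∈ φ.source` read on the model
  have hcrit_iff : ∀ q ∈ φ.source, (¬ Surjective (mfderiv (𝓡 4) (𝓡 2) g q) ↔
      fderiv ℝ h ((φ q) 0, (φ q) 1) ((0 : ℝ), (1 : ℝ)) = 0 ∧ ε₂ * (φ q) 2 = 0 ∧
        ε₃ * (φ q) 3 = 0) := by
    intro q hq
    have hGd : DifferentiableAt ℝ G (φ q) :=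
      (hGs.contDiffAt (hΩo.mem_nhds (hφΩ q hq))).differentiableAt (by simp)
    rw [surjective_mfderiv_iff_of_localRepresentative hφ hφs hψ hψs hmaps hq hGd (hGf q hq)]
    exact critical_cuspModel_iff hU hh (hφΩ q hq)
  -- the planar curve
  obtain ⟨V, τ, W, hVo, h0V, hτs, hτ0, hτgraph, hWo, h0W, hWU, hWuniq⟩ :=
    exists_cuspCritCurve hU h0U hh hx htx
  -- restrict to an interval on which the arc stays in the chart target
  have hyc : ContinuousOn (fun x => arcPt (τ x) x) V := (contDiffOn_arcPt hτs).continuousOn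
  have hy0 : arcPt (τ 0) 0 = 0 := by
    rw [hτ0]
    ext i
    fin_cases i <;> rfl
  have h0t : (0 : 𝔼 4) ∈ φ.target := hp0 ▸ φ.map_source hpφ
  set D : Set ℝ := V ∩ (fun x => arcPt (τ x) x) ⁻¹' φ.target with hD
  have hDo : IsOpen D := hyc.isOpen_inter_preimage hVo φ.open_target
  have h0D : (0 : ℝ) ∈ D := ⟨h0V, by rw [mem_preimage, hy0]; exact h0t⟩
  obtain ⟨δ, hδ, hball⟩ := Metric.isOpen_iff.1 hDo 0 h0D
  have hIoo : Ioo (-δ) δ ⊆ D := by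
    intro x hx
    apply hball
    rw [Metric.mem_ball, dist_zero_right, Real.norm_eq_abs, abs_lt]
    exact hx
  set γ : ℝ → X := fun x => φ.symm (arcPt (τ x) x) with hγ
  have hγsrc : ∀ x ∈ Ioo (-δ) δ, γ x ∈ φ.source := fun x hx => φ.map_target (hIoo hx).2
  have hφγ : ∀ x ∈ Ioo (-δ) δ, φ (γ x) = arcPt (τ x) x := fun x hx => φ.right_inv (hIoo hx).2
  refine ⟨δ, γ, hδ, ?_, ?_, ?_, ?_, ?_⟩
  · show φ.symm (arcPt (τ 0) 0) = p
    rw [hy0, ← hp0, φ.left_inv hpφ]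
  · have h1 : ContMDiffOn 𝓘(ℝ, ℝ) (𝓡 4) ∞ (fun x => arcPt (τ x) x) (Ioo (-δ) δ) :=
      ((contDiffOn_arcPt hτs).mono fun x hx => (hIoo hx).1).contMDiffOn
    exact hφs.comp h1 fun x hx => (hIoo hx).2
  · intro x hx x' hx' hxx'
    have h1 : arcPt (τ x) x = arcPt (τ x') x' := by rw [← hφγ x hx, ← hφγ x' hx', hxx']
    simpa using congrArg (fun v : 𝔼 4 => v 1) h1
  · intro x hx
    rw [hcrit_iff (γ x) (hγsrc x hx), hφγ x hx]
    refine ⟨?_, by simp, by simp⟩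
    simpa using (hτgraph x (hIoo hx).1).2
  · refine ⟨φ.source ∩ φ ⁻¹' (Ω ∩ OneJet.baseProj ⁻¹' W ∩ {y | y 1 ∈ Ioo (-δ) δ}), ?_, ?_⟩
    · have ho : IsOpen (Ω ∩ OneJet.baseProj ⁻¹' W ∩ {y : 𝔼 4 | y 1 ∈ Ioo (-δ) δ}) :=
        (hΩo.inter (hWo.preimage OneJet.baseProj.continuous)).inter
          (isOpen_Ioo.preimage (EuclideanSpace.proj (1 : Fin 4) : 𝔼 4 →L[ℝ] ℝ).continuous)
      refine (φ.continuousOn.isOpen_inter_preimage φ.open_source ho).mem_nhds ⟨hpφ, ?_⟩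
      rw [mem_preimage, hp0]
      refine ⟨⟨?_, ?_⟩, ?_⟩
      · show OneJet.baseProj (0 : 𝔼 4) ∈ U
        rw [map_zero]; exact h0U
      · show OneJet.baseProj (0 : 𝔼 4) ∈ W
        rw [map_zero]; exact h0W
      · show (0 : 𝔼 4) 1 ∈ Ioo (-δ) δ
        simpa using hδ
    · rintro q ⟨hq, ⟨⟨-, hqW⟩, hq1⟩⟩ hcrit
      rw [hcrit_iff q hq] at hcrit
      obtain ⟨hxq, h2, h3⟩ := hcrit
      have hy2 : φ q 2 = 0 := (mul_eq_zero.1 h2).resolve_left hε₂0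
      have hy3 : φ q 3 = 0 := (mul_eq_zero.1 h3).resolve_left hε₃0
      obtain ⟨-, hτq⟩ := hWuniq ((φ q) 0, (φ q) 1) hqW hxq
      have hφq : φ q = arcPt (τ (φ q 1)) (φ q 1) := by
        rw [eq_arcPt hy2 hy3]
        simpa using congrArg (fun r : ℝ × ℝ => arcPt r.1 r.2) hτq
      refine ⟨φ q 1, hq1, ?_⟩
      show φ.symm (arcPt (τ (φ q 1)) (φ q 1)) = q
      rw [← hφq, φ.left_inv hq]

end Literature.Topology.FourManifolds
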